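import Mathlib
import Summits.Ventures.PercRepro2.Tail2DBlockCalc
import Summits.Ventures.PercRepro2.Tail2DHarrisSP
import Summits.Ventures.PercRepro2.Tail2DFlowOneBlocks
import Summits.Ventures.PercRepro2.Tail2DFlowOneStep01
import Summits.Ventures.PercRepro2.Tail2DParFin
import Summits.Ventures.PercRepro2.Tail2DParFinFlip
import Summits.Ventures.PercRepro2.Tail2DParFinTop

/-!
# Words of `k` flow-one factors: the relax move `R → col` at one position, and the algebra of the sub-top level
(seat mine-b, cell pub-perc-repro2; conjectures/MINE-B.md §44)

`blockCol w i` is the product block with `col = C ⊔ B` at position `i` (the union of the blocks of the two words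
`w[i := B]`, `w[i := C]`); for `w i = R` the block of `w` is dominated by it (`blockDom_col`, the product coupling of
`R ≼ col` at `i` with identities elsewhere).  The second half is the pure arithmetic of the sub-top certificate: with
`N = (k+1)/(u+1) + (v+1)x`, `D = (k+1)/(v+2) + ux` (`x = Γ/k ≥ 0`, `k = u+v+1`, `u ≥ v+2`) the rates
`ι = N/D − (v+1)/(u+1)`, `ξ = N/D − (v+1)/u` are non-negative, the flip rate has the margin
`(1−ι)/u − ξ(1 + (v+2)x) = [(k+1)(v+1)/((u+1)(v+2)) + x(v+1)²/(u+1)]/(uD) ≥ 0`, and the class-0 top words receive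
`(v+2)((1−ι)/u − ξx) = N/D`.
-/

namespace Summit.Ventures.PercRepro2.Tail2D

open V2Closure Finset

section Relax

/-- the block with `col = C ⊔ B` at position `i`: the union of the blocks of the two words `w[i := B]`, `w[i := C]` -/
def blockCol (k : ℕ) (X : Fin k → V2Closure.SP) (w : Fin k → Ltr) (i : Fin k) : Finset (parFin k X).Conf :=
  blockOf k X (Function.update w i Ltr.B) ∪ blockOf k X (Function.update w i Ltr.C)

/-- the two words of a `col` block differ -/
theorem update_B_ne_update_C (k : ℕ) (w : Fin k → Ltr) (i : Fin k) :
    Function.update w i Ltr.B ≠ Function.update w i Ltr.C := by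
  intro h
  have := congrFun h i
  simp at this

/-- the size of a `col` block is the sum of the sizes of its two word blocks -/
theorem card_blockCol (k : ℕ) (X : Fin k → V2Closure.SP) (hX : ∀ i, FlowOne (X i)) (w : Fin k → Ltr) (i : Fin k) :
    (blockCol k X w i).card
      = (blockOf k X (Function.update w i Ltr.B)).card + (blockOf k X (Function.update w i Ltr.C)).card :=
  Finset.card_union_of_disjoint (blockOf_disjoint k X hX (update_B_ne_update_C k w i))

/-- membership in a `col` block, by the word -/
theorem mem_blockCol_iff (k : ℕ) (X : Fin k → V2Closure.SP) (hX : ∀ i, FlowOne (X i)) (w : Fin k → Ltr) (i : Fin k)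
    (z : (parFin k X).Conf) :
    z ∈ blockCol k X w i ↔ wordOf k X z = Function.update w i Ltr.B ∨ wordOf k X z = Function.update w i Ltr.C := by
  unfold blockCol
  rw [Finset.mem_union]
  constructor
  · rintro (h | h)
    · exact Or.inl (wordOf_eq_of_mem_blockOf k X hX z _ h)
    · exact Or.inr (wordOf_eq_of_mem_blockOf k X hX z _ h)
  · rintro (h | h)
    · left; rw [← h]; exact mem_blockOf_wordOf k X hX z
    · right; rw [← h]; exact mem_blockOf_wordOf k X hX z

/-- the uniform density of a `col` block -/
theorem unifDens_blockCol (k : ℕ) (X : Fin k → V2Closure.SP) (hX : ∀ i, FlowOne (X i)) (w : Fin k → Ltr) (i : Fin k)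
    (z : (parFin k X).Conf) :
    unifDens (parFin k X) (blockCol k X w i) z
      = if wordOf k X z = Function.update w i Ltr.B ∨ wordOf k X z = Function.update w i Ltr.C
        then ((blockCol k X w i).card : ℚ)⁻¹ else 0 := by
  unfold unifDens
  by_cases h : z ∈ blockCol k X w i
  · rw [if_pos h, if_pos ((mem_blockCol_iff k X hX w i z).1 h)]
  · rw [if_neg h, if_neg (fun h' => h ((mem_blockCol_iff k X hX w i z).2 h'))]

/-- for a flow-one factor `col = B ⊔ C` -/
theorem colSet_eq_union (s : V2Closure.SP) (hs : FlowOne s) : colSet s = bSet s ∪ cellSet s := by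
  ext x
  rw [Finset.mem_union, mem_colSet, mem_bSet, mem_cellSet]
  rcases flowOne_cases s hs x with h | h | h <;> simp [h.1, h.2]

/-- **`R ≼ col` at one position**: the block of a word with `R` at `i` is dominated by its `col` block -/
theorem blockDom_col : ∀ (k : ℕ) (X : Fin k → V2Closure.SP), (∀ i, FlowOne (X i)) →
    ∀ (w : Fin k → Ltr) (i : Fin k), w i = Ltr.R → BlockDom (parFin k X) (blockOf k X w) (blockCol k X w i)
  | 0, _, _, _, i, _ => Fin.elim0 i
  | k + 1, X, hX, w, i, hi => by
      rcases Fin.eq_zero_or_eq_succ i with rfl | ⟨j, rfl⟩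
      · -- the relaxed factor is the head
        have e : blockCol (k + 1) X w 0
            = (colSet (X 0) ×ˢ blockOf k (Fin.tail X) (Fin.tail w) :
                Finset ((X 0).Conf × (parFin k (Fin.tail X)).Conf)) := by
          unfold blockCol
          show (letterSet (X 0) (Function.update w 0 Ltr.B 0) ×ˢ blockOf k (Fin.tail X) (Fin.tail (Function.update w 0 Ltr.B)) :
              Finset ((X 0).Conf × (parFin k (Fin.tail X)).Conf))
            ∪ (letterSet (X 0) (Function.update w 0 Ltr.C 0) ×ˢ blockOf k (Fin.tail X) (Fin.tail (Function.update w 0 Ltr.C)) :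
              Finset ((X 0).Conf × (parFin k (Fin.tail X)).Conf)) = _
          rw [Fin.tail_update_zero, Fin.tail_update_zero, Function.update_self, Function.update_self,
            colSet_eq_union (X 0) (hX 0), Finset.union_product]
          rfl
        rw [e]
        show BlockDom (V2Closure.SP.par (X 0) (parFin k (Fin.tail X)))
          (letterSet (X 0) (w 0) ×ˢ blockOf k (Fin.tail X) (Fin.tail w)) _
        rw [hi]
        exact blockDom_prod_par _ _ (dom_r_col (X 0)) (blockDom_refl _ _)
      · -- the relaxed factor is in the tail
        have e : blockCol (k + 1) X w j.succ
            = (letterSet (X 0) (w 0) ×ˢ blockCol k (Fin.tail X) (Fin.tail w) j :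
                Finset ((X 0).Conf × (parFin k (Fin.tail X)).Conf)) := by
          unfold blockCol
          show (letterSet (X 0) (Function.update w j.succ Ltr.B 0) ×ˢ blockOf k (Fin.tail X) (Fin.tail (Function.update w j.succ Ltr.B)) :
              Finset ((X 0).Conf × (parFin k (Fin.tail X)).Conf))
            ∪ (letterSet (X 0) (Function.update w j.succ Ltr.C 0) ×ˢ blockOf k (Fin.tail X) (Fin.tail (Function.update w j.succ Ltr.C)) :
              Finset ((X 0).Conf × (parFin k (Fin.tail X)).Conf)) = _
          rw [Fin.tail_update_succ, Fin.tail_update_succ, Function.update_of_ne (Fin.succ_ne_zero j).symm,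
            Function.update_of_ne (Fin.succ_ne_zero j).symm, Finset.product_union]
        rw [e]
        show BlockDom (V2Closure.SP.par (X 0) (parFin k (Fin.tail X)))
          (letterSet (X 0) (w 0) ×ˢ blockOf k (Fin.tail X) (Fin.tail w)) _
        exact blockDom_prod_par _ _ (blockDom_refl _ _)
          (blockDom_col k (Fin.tail X) (fun i => hX i.succ) (Fin.tail w) j hi)

end Relax

section Algebra

/-! The arithmetic of the sub-top certificate, in the normalised variables. -/

variable (u v : ℕ) (x : ℚ)

/-- `N = (k+1)/(u+1) + (v+1)x`, the source mass over `M = A·C(k,v+1)` -/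
noncomputable def subN : ℚ := ((u + v + 2 : ℕ) : ℚ) / (u + 1) + (v + 1) * x
/-- `D = (k+1)/(v+2) + ux`, the target mass over `M` -/
noncomputable def subD : ℚ := ((u + v + 2 : ℕ) : ℚ) / (v + 2) + u * x

/-- `D > 0` -/
theorem subD_pos (hx : 0 ≤ x) : 0 < subD u v x := by
  unfold subD; positivity

/-- `ξ = N/D − (v+1)/u ≥ 0` for `u ≥ v+1` -/
theorem sub_xi_nonneg (hx : 0 ≤ x) (huv : v + 1 ≤ u) : 0 ≤ subN u v x / subD u v x - (v + 1) / u := by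
  have hD := subD_pos u v x hx
  have hu : (0 : ℚ) < u := by exact_mod_cast (show 0 < u by omega)
  have key : subN u v x / subD u v x - (v + 1) / u
      = ((u + v + 2 : ℚ) * (u - v - 1)) / ((u + 1) * (v + 2)) / (u * subD u v x) := by
    unfold subN subD
    push_cast
    field_simp
    ring
  rw [key]
  have h1 : (0 : ℚ) ≤ u - v - 1 := by
    have : ((v + 1 : ℕ) : ℚ) ≤ u := by exact_mod_cast huv
    push_cast at this; linarith
  positivity

/-- `ι = N/D − (v+1)/(u+1) ≥ 0` for `u ≥ v+1` -/
theorem sub_iota_nonneg (hx : 0 ≤ x) (huv : v + 1 ≤ u) : 0 ≤ subN u v x / subD u v x - (v + 1) / (u + 1) := by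
  have h := sub_xi_nonneg u v x hx huv
  have hu : (0 : ℚ) < u := by exact_mod_cast (show 0 < u by omega)
  have : ((v : ℚ) + 1) / (u + 1) ≤ (v + 1) / u := by
    apply div_le_div_of_nonneg_left (by positivity) hu (by linarith)
  linarith

/-- the flip margin: `(1−ι)/u − ξ(1 + (v+2)x) ≥ 0` -/
theorem sub_flip_margin (hx : 0 ≤ x) (huv : v + 1 ≤ u) :
    0 ≤ (1 - (subN u v x / subD u v x - (v + 1) / (u + 1))) / u
      - (subN u v x / subD u v x - (v + 1) / u) * (1 + (v + 2) * x) := by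
  have hD := subD_pos u v x hx
  have hu : (0 : ℚ) < u := by exact_mod_cast (show 0 < u by omega)
  have key : (1 - (subN u v x / subD u v x - (v + 1) / (u + 1))) / u
      - (subN u v x / subD u v x - (v + 1) / u) * (1 + (v + 2) * x)
      = (((u + v + 2 : ℚ) * (v + 1)) / ((u + 1) * (v + 2)) + x * (v + 1) ^ 2 / (u + 1)) / (u * subD u v x) := by
    unfold subN subD
    push_cast
    field_simp
    ring
  rw [key]
  positivity

/-- the class-0 top identity: `(v+2)((1−ι)/u − ξx) = N/D` -/
theorem sub_top_identity (hx : 0 ≤ x) (huv : v + 1 ≤ u) :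
    (v + 2 : ℚ) * ((1 - (subN u v x / subD u v x - (v + 1) / (u + 1))) / u
      - (subN u v x / subD u v x - (v + 1) / u) * x) = subN u v x / subD u v x := by
  have hD := subD_pos u v x hx
  have hu : (0 : ℚ) < u := by exact_mod_cast (show 0 < u by omega)
  unfold subN subD
  push_cast
  field_simp
  ring

end Algebra

end Summit.Ventures.PercRepro2.Tail2D
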